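import Mathlib
import Summits.ValiantsHypothesis.ValiantsHypothesis.Theorems.BarrierLeverPartitionMinorsHitByVPHiddenStatesSymbolic

/-!
# Route BarrierLever — item `PartitionMinorsHitByVP` (stmt-ValiantsHypothesis-19717), line `hidden-states`:
# THE AFFINE-CLOSURE CUT LEMMA — which column sets are exact zero sets of one cut

Helper file (`--supports stmt-ValiantsHypothesis-19717`; cell valiant-natproofs, rung V4, 𝒟-side door (c), registered line
`Cruxes/PartitionMinorsHitByVP/Lines/hidden_states.lean`, lane `stub_universalJoinWide` / `stub_fit`; prover seat val-np-p6 gen 8).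
No definitions. Closes NO item.

THE POINT (memo val-np-p6 g8 «cut-tree certifiability» §1.2). A node of a `Fit` certificate (`SymbJoin.symGood_of_split`, val-np-p3 g10)
needs CUT CONSTANTS `β_p, γ_{p,q}` whose cut values `ξ_k = β_p + Σ_{q∈J} γ_{p,q}` (`SymbJoin.xi`) vanish EXACTLY on a prescribed set `C₀`
of columns. This file proves the combinatorial criterion: such constants exist as soon as, inside every piece, no column outside `C₀` has
its affine row vector `(1, 1_J)` in the linear span of the affine row vectors of the `C₀`-columns of the same piece — i.e. `C₀ ∩ piece`
is AFFINELY CLOSED among the piece's columns (`exists_cut_of_affClosed`). So certificate search is pure combinatorics (choose affinely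
closed sub-families with the right counts); the numeric constants are supplied here once and for all. Engine: over `ℂ` a finite family
of vectors outside a subspace admits ONE linear functional vanishing on the subspace and on none of them (`exists_dual_forall_ne_zero`,
from `Submodule.exists_dual_map_eq_bot_of_notMem` and an avoid-finitely-many-values step).

WHAT THIS IS NOT: no family is certified here; item 19717 OPEN; nothing on crux 14610 or VP ≠ VNP.
-/

set_option linter.dupNamespace false

namespace Summit.ValiantsHypothesis.ValiantsHypothesis.Theorems.BarrierLever.HiddenStates

open Finset Matrix MvPolynomial

noncomputable section

namespace SymbJoin

variable {m K r : ℕ}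

/-! ## 1. One functional vanishing on a subspace and on none of finitely many outside vectors -/

/-- Over `ℂ`: given a subspace `p` and finitely many vectors outside `p`, some linear functional kills `p` and none of the vectors. -/
theorem exists_dual_forall_ne_zero {M : Type*} [AddCommGroup M] [Module ℂ M] (p : Submodule ℂ M) (S : Finset M)
    (hS : ∀ x ∈ S, x ∉ p) :
    ∃ f : Module.Dual ℂ M, (∀ y ∈ p, f y = 0) ∧ ∀ x ∈ S, f x ≠ 0 := by
  classical
  induction S using Finset.induction_on with
  | empty => exact ⟨0, fun y _ => rfl, fun x hx => absurd hx (Finset.notMem_empty x)⟩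
  | @insert a S ha ih =>
    obtain ⟨g, hgp, hgS⟩ := ih (fun x hx => hS x (Finset.mem_insert_of_mem hx))
    have hap : a ∉ p := hS a (Finset.mem_insert_self a S)
    obtain ⟨fa, hfa, hfap⟩ := Submodule.exists_dual_map_eq_bot_of_notMem hap inferInstance
    have hfap' : ∀ y ∈ p, fa y = 0 := by
      intro y hy
      have : fa y ∈ Submodule.map fa p := Submodule.mem_map_of_mem hy
      rw [hfap] at this
      simpa using this
    -- avoid the finitely many bad parameters t
    let bad : Finset ℂ := insert (-(g a) / fa a) (S.image fun x => -(g x) / fa x)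
    obtain ⟨t, ht⟩ := Infinite.exists_notMem_finset bad
    refine ⟨g + t • fa, ?_, ?_⟩
    · intro y hy
      simp [hgp y hy, hfap' y hy]
    · intro x hx
      rw [Finset.mem_insert] at hx
      simp only [LinearMap.add_apply, LinearMap.smul_apply, smul_eq_mul]
      rcases hx with rfl | hx
      · -- x = a : g a + t * fa a = 0 would force t = -(g a)/fa a ∈ bad
        intro h0
        apply ht
        have : t = -(g x) / fa x := by field_simp; linear_combination h0
        rw [this]; exact Finset.mem_insert_self _ _
      · intro h0
        by_cases hfx : fa x = 0
        · rw [hfx, mul_zero, add_zero] at h0; exact hgS x hx h0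
        · apply ht
          have : t = -(g x) / fa x := by field_simp; linear_combination h0
          rw [this]; exact Finset.mem_insert_of_mem (Finset.mem_image_of_mem _ hx)

/-! ## 2. The cut lemma -/

/-- **THE AFFINE-CLOSURE CUT LEMMA.** Let `C₀` be a set of columns. Suppose that for every column `k ∉ C₀` the affine row vector
`(1, 1_{J_k})` (as a function `Option (Fin K) → ℂ`, `none ↦ 1`, `some q ↦ [q ∈ J_k]`) is NOT in the span of the affine row vectors of the
`C₀`-columns of the same piece. Then there are cut constants `β, γ` whose cut values `ξ_k` vanish exactly on `C₀`. -/
theorem exists_cut_of_affClosed (e : Fin r → Fin m × Finset (Fin K)) (C₀ : Finset (Fin r))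
    (haff : ∀ k, k ∉ C₀ →
      (fun o : Option (Fin K) => Option.elim o (1 : ℂ) fun q => if q ∈ (e k).2 then 1 else 0) ∉
        Submodule.span ℂ ((fun k' => fun o : Option (Fin K) => Option.elim o (1 : ℂ) fun q => if q ∈ (e k').2 then 1 else 0) ''
          {k' | k' ∈ C₀ ∧ (e k').1 = (e k).1})) :
    ∃ (β : Fin m → ℂ) (γ : Fin m → Fin K → ℂ), ∀ k, xi e β γ k = 0 ↔ k ∈ C₀ := by
  classical
  -- affine row vectors
  let a : Fin r → (Option (Fin K) → ℂ) := fun k o => Option.elim o (1 : ℂ) fun q => if q ∈ (e k).2 then 1 else 0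
  -- per piece: the span of the C₀-rows and the finite set of outside rows
  let V : Fin m → Submodule ℂ (Option (Fin K) → ℂ) := fun p =>
    Submodule.span ℂ (a '' {k' | k' ∈ C₀ ∧ (e k').1 = p})
  let S : Fin m → Finset (Option (Fin K) → ℂ) := fun p =>
    (Finset.univ.filter fun k => k ∉ C₀ ∧ (e k).1 = p).image a
  have hS : ∀ p, ∀ x ∈ S p, x ∉ V p := by
    intro p x hx
    simp only [S, Finset.mem_image, Finset.mem_filter, Finset.mem_univ, true_and] at hx
    obtain ⟨k, ⟨hkC, hkp⟩, rfl⟩ := hx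
    have := haff k hkC
    rw [hkp] at this
    exact this
  have hψ : ∀ p, ∃ f : Module.Dual ℂ (Option (Fin K) → ℂ), (∀ y ∈ V p, f y = 0) ∧ ∀ x ∈ S p, f x ≠ 0 :=
    fun p => exists_dual_forall_ne_zero (V p) (S p) (hS p)
  choose ψ hψV hψS using hψ
  refine ⟨fun p => ψ p (fun o => if o = none then 1 else 0), fun p q => ψ p (fun o => if o = some q then 1 else 0), fun k => ?_⟩
  -- the cut value of column k is ψ_p applied to its affine row vector
  have hdecomp : a k = (fun o => if o = none then (1 : ℂ) else 0) + ∑ q ∈ (e k).2, (fun o => if o = some q then (1 : ℂ) else 0) := by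
    funext o
    rw [Pi.add_apply, Finset.sum_apply]
    cases o with
    | none => simp [a]
    | some q' =>
      simp only [a, Option.elim_some, reduceCtorEq, if_false, zero_add, Option.some.injEq]
      rw [Finset.sum_ite_eq (e k).2 q']
  have hxi : xi e (fun p => ψ p (fun o => if o = none then 1 else 0)) (fun p q => ψ p (fun o => if o = some q then 1 else 0)) k
      = ψ (e k).1 (a k) := by
    rw [xi, hdecomp, map_add, map_sum]
  rw [hxi]
  constructor
  · intro h0
    by_contra hkC
    have hmem : a k ∈ S (e k).1 := by
      simp only [S, Finset.mem_image, Finset.mem_filter, Finset.mem_univ, true_and]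
      exact ⟨k, ⟨hkC, rfl⟩, rfl⟩
    exact hψS (e k).1 (a k) hmem h0
  · intro hkC
    apply hψV
    exact Submodule.subset_span ⟨k, ⟨hkC, rfl⟩, rfl⟩

end SymbJoin

end

end Summit.ValiantsHypothesis.ValiantsHypothesis.Theorems.BarrierLever.HiddenStates
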